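import Literature.MathematicalPhysics.QuantumLattice.HubbardTotalTadpole
import HarnessLib

/-!
# The Hartree counterterm of a complex coupling: two Picard iterations of the total tadpole

Topic `MathematicalPhysics/QuantumLattice`; cell gate-hubbard-kl, R0-SCOPE-4 P7 (choice of the quadratic counterterm).  The flow of
`HubbardGridFlowBudget` needs the final quadratic coupling `ν_{K+1} = ν₀ + u Σ_j t_j = ν₀ + u T(w)` to be of size `≤ |u|π/β`, where
`T = totalTadpole L M β μ` is the total tadpole at the complex shift `w` of the chemical potential and the shift itself is
`w = -u/2 + ν₀` (`ν₀ = -uT₁`).  The exact Hartree condition `ν₀ = -uT(-u/2 + ν₀)` is a fixed-point equation; two Picard iterations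
suffice: with `T₀ = T(-u/2)`, `T₁ = T(-u/2 - uT₀)` (`hartreeT0`, `hartreeT1`) and `w = -u/2 - uT₁` (`hartreeShift`), the Lipschitz bound
of the tadpole on the box `|Re s| ≤ δ`, `|Im s| ≤ π/(4β)` (`norm_totalTadpole_sub_le`, constant `tadpoleLip d₀ β L ~ log β`) gives
* `norm_hartreeT0_le_one`, `norm_hartreeT1_le_one` (the real tadpole is `≤ ½`, the imaginary excursion costs `Lip·|Im|`),
* `hartreeShift_mem_box` (`|Re w| ≤ δ`, `|β Im w| ≤ π/4`),
* **`norm_hartree_residual_le`**: `‖-uT₁ + uT(w)‖ ≤ |u|³ Lip² ≤ |u| π/β` for `|u| ≤ κ_U/β` and `κ_U² Lip² ≤ πβ`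
(Benfatto–Giuliani–Mastropietro 2006, §2.3: the counterterm `ν` is fixed by the tadpole; here to the accuracy the flow needs).

Everything is proved; the four definitions are abbreviations; no named facts.

## Sources

G. Benfatto, A. Giuliani, V. Mastropietro, Ann. Henri Poincaré 7 (2006) 809–898, §2.3 (2.21)–(2.24) (`BenfattoGiulianiMastropietro2006`).
-/

noncomputable section

namespace Literature.MathematicalPhysics.QuantumLattice

open Complex

variable (L M : ℕ) [NeZero L]

/-- **The Lipschitz constant of the total tadpole** on the box (`norm_totalTadpole_sub_le`).
[cite: BenfattoGiulianiMastropietro2006, §2.3 (2.21)-(2.22)] -/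
def tadpoleLip (d₀ β : ℝ) : ℝ :=
  16 / 9 * (1 / d₀ + (4 * (Real.log (d₀ * β / 3) / Real.log 2 + 2) + 2) / (2 * Real.pi * Real.sqrt (d₀ / 8)) + 20 / 3 * (β / L))

/-- The zeroth Picard iterate `T₀ = T(-u/2)`. [cite: BenfattoGiulianiMastropietro2006, §2.3 (2.23)] -/
def hartreeT0 (β μ : ℝ) (u : ℂ) : ℂ := totalTadpole L M β μ (-(u / 2))

/-- The first Picard iterate `T₁ = T(-u/2 - uT₀)`. [cite: BenfattoGiulianiMastropietro2006, §2.3 (2.23)] -/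
def hartreeT1 (β μ : ℝ) (u : ℂ) : ℂ := totalTadpole L M β μ (-(u / 2) - u * hartreeT0 L M β μ u)

/-- **The complex shift of the chemical potential** `w = -u/2 - uT₁`. [cite: BenfattoGiulianiMastropietro2006, §2.3 (2.23)] -/
def hartreeShift (β μ : ℝ) (u : ℂ) : ℂ := -(u / 2) - u * hartreeT1 L M β μ u

variable {L M}

omit [NeZero L] in
/-- The Lipschitz constant is nonnegative for `β ≥ 3/d₀`. [cite: BenfattoGiulianiMastropietro2006, §2.3 (2.22)] -/
theorem tadpoleLip_nonneg {d₀ β : ℝ} (hd₀ : 0 < d₀) (hβ : 3 / d₀ ≤ β) : 0 ≤ tadpoleLip L d₀ β := by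
  have hβ0 : 0 < β := lt_of_lt_of_le (by positivity) hβ
  have hlog : 0 ≤ Real.log (d₀ * β / 3) := Real.log_nonneg (by rw [le_div_iff₀ (by norm_num)]; rw [div_le_iff₀ hd₀] at hβ; linarith)
  have hlog2 : 0 < Real.log 2 := Real.log_pos one_lt_two
  unfold tadpoleLip
  positivity

/-- **The tadpole on the box**: `‖T(s)‖ ≤ ½ + Lip·|Im s|` (the real tadpole is `≤ ½`). [cite: BenfattoGiulianiMastropietro2006, §2.3 (2.22)] -/
theorem norm_totalTadpole_le_of_mem_box {d₀ δ β μ : ℝ} (hd₀ : 0 < d₀) (hμ4 : d₀ + δ ≤ μ + 4) (hμ0 : d₀ + δ ≤ -μ) (hβ : 3 / d₀ ≤ β)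
    {s : ℂ} (hre : |s.re| ≤ δ) (him : |s.im| ≤ Real.pi / (4 * β)) :
    ‖totalTadpole L M β μ s‖ ≤ 1 / 2 + tadpoleLip L d₀ β * |s.im| := by
  have hβ0 : 0 < β := lt_of_lt_of_le (by positivity) hβ
  have hreal := norm_totalTadpole_ofReal_le (L := L) (M := M) hβ0 μ s.re
  have hre' : |((s.re : ℂ)).re| ≤ δ := by simpa using hre
  have him' : |((s.re : ℂ)).im| ≤ Real.pi / (4 * β) := by simp; positivity
  have hdiff := norm_totalTadpole_sub_le (L := L) (M := M) hd₀ hμ4 hμ0 hβ hre him hre' him'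
  have hsub : ‖s - (s.re : ℂ)‖ = |s.im| := by
    have : s - (s.re : ℂ) = (s.im : ℂ) * I := by
      apply Complex.ext <;> simp
    rw [this, norm_mul, Complex.norm_I, mul_one, Complex.norm_real, Real.norm_eq_abs]
  rw [hsub] at hdiff
  calc ‖totalTadpole L M β μ s‖ = ‖totalTadpole L M β μ (s.re : ℂ) + (totalTadpole L M β μ s - totalTadpole L M β μ (s.re : ℂ))‖ := by
        rw [add_sub_cancel]
    _ ≤ ‖totalTadpole L M β μ (s.re : ℂ)‖ + ‖totalTadpole L M β μ s - totalTadpole L M β μ (s.re : ℂ)‖ := norm_add_le _ _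
    _ ≤ 1 / 2 + tadpoleLip L d₀ β * |s.im| := add_le_add hreal (by rw [tadpoleLip]; exact hdiff)

section

variable {d₀ δ β μ κU : ℝ} (hd₀ : 0 < d₀) (hμ4 : d₀ + δ ≤ μ + 4) (hμ0 : d₀ + δ ≤ -μ) (hβ : 3 / d₀ ≤ β)
  (hbox1 : 3 / 2 * κU ≤ Real.pi / 4) (hbox2 : 3 / 2 * κU / β ≤ δ) (hLip : 3 * tadpoleLip L d₀ β * κU ≤ β)
  {u : ℂ} (hu : ‖u‖ ≤ κU / β)
include hd₀ hμ4 hμ0 hβ hbox1 hbox2 hLip hu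

omit [NeZero L] hμ4 hμ0 hLip in
/-- A point `-u/2 - ut` with `‖t‖ ≤ 1` lies in the box. [cite: BenfattoGiulianiMastropietro2006, §2.3 (2.23)] -/
theorem hartree_point_mem_box {t : ℂ} (ht : ‖t‖ ≤ 1) :
    |(-(u / 2) - u * t).re| ≤ δ ∧ |(-(u / 2) - u * t).im| ≤ Real.pi / (4 * β) ∧ |β * (-(u / 2) - u * t).im| ≤ Real.pi / 4 := by
  have hβ0 : 0 < β := lt_of_lt_of_le (by positivity) hβ
  have hn : ‖-(u / 2) - u * t‖ ≤ 3 / 2 * κU / β := by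
    calc ‖-(u / 2) - u * t‖ ≤ ‖-(u / 2)‖ + ‖u * t‖ := norm_sub_le _ _
      _ = ‖u‖ / 2 + ‖u‖ * ‖t‖ := by rw [norm_neg, norm_div, norm_mul]; simp
      _ ≤ ‖u‖ / 2 + ‖u‖ * 1 := by gcongr
      _ = 3 / 2 * ‖u‖ := by ring
      _ ≤ 3 / 2 * (κU / β) := by gcongr
      _ = 3 / 2 * κU / β := by ring
  have hre := (abs_re_le_norm _).trans hn
  have him := (abs_im_le_norm _).trans hn
  have him' : β * |(-(u / 2) - u * t).im| ≤ Real.pi / 4 := by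
    have := mul_le_mul_of_nonneg_left him hβ0.le
    rw [mul_div_assoc', mul_div_cancel_left₀ _ hβ0.ne', mul_comm (3 / 2 : ℝ)] at this
    linarith
  refine ⟨hre.trans hbox2, ?_, ?_⟩
  · rw [le_div_iff₀ (by positivity)]; linarith
  · rw [abs_mul, abs_of_pos hβ0]; exact him'

/-- The imaginary excursion costs at most `½`: `Lip · (3κ_U/(2β)) ≤ ½`. [cite: BenfattoGiulianiMastropietro2006, §2.3 (2.23)] -/
theorem norm_totalTadpole_hartree_point_le_one {t : ℂ} (ht : ‖t‖ ≤ 1) : ‖totalTadpole L M β μ (-(u / 2) - u * t)‖ ≤ 1 := by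
  have hβ0 : 0 < β := lt_of_lt_of_le (by positivity) hβ
  obtain ⟨hre, him, -⟩ := hartree_point_mem_box hd₀ hβ hbox1 hbox2 hu ht
  have h1 := norm_totalTadpole_le_of_mem_box (L := L) (M := M) hd₀ hμ4 hμ0 hβ hre him
  have hL0 := tadpoleLip_nonneg (L := L) hd₀ hβ
  have him2 : |(-(u / 2) - u * t).im| ≤ 3 / 2 * κU / β := by
    refine (abs_im_le_norm _).trans ?_
    calc ‖-(u / 2) - u * t‖ ≤ ‖-(u / 2)‖ + ‖u * t‖ := norm_sub_le _ _
      _ = ‖u‖ / 2 + ‖u‖ * ‖t‖ := by rw [norm_neg, norm_div, norm_mul]; simp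
      _ ≤ ‖u‖ / 2 + ‖u‖ * 1 := by gcongr
      _ ≤ 3 / 2 * (κU / β) := by linarith
      _ = 3 / 2 * κU / β := by ring
  have h2 : tadpoleLip L d₀ β * |(-(u / 2) - u * t).im| ≤ 1 / 2 := by
    calc tadpoleLip L d₀ β * |(-(u / 2) - u * t).im| ≤ tadpoleLip L d₀ β * (3 / 2 * κU / β) := mul_le_mul_of_nonneg_left him2 hL0
      _ = 3 * tadpoleLip L d₀ β * κU / (2 * β) := by ring
      _ ≤ β / (2 * β) := by gcongr
      _ = 1 / 2 := by field_simp
  linarith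

/-- **`‖T₀‖ ≤ 1`.** [cite: BenfattoGiulianiMastropietro2006, §2.3 (2.23)] -/
theorem norm_hartreeT0_le_one : ‖hartreeT0 L M β μ u‖ ≤ 1 := by
  have h := norm_totalTadpole_hartree_point_le_one (M := M) hd₀ hμ4 hμ0 hβ hbox1 hbox2 hLip hu (t := 0) (by simp)
  simpa [hartreeT0] using h

/-- **`‖T₁‖ ≤ 1`.** [cite: BenfattoGiulianiMastropietro2006, §2.3 (2.23)] -/
theorem norm_hartreeT1_le_one : ‖hartreeT1 L M β μ u‖ ≤ 1 :=
  norm_totalTadpole_hartree_point_le_one (M := M) hd₀ hμ4 hμ0 hβ hbox1 hbox2 hLip hu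
    (norm_hartreeT0_le_one hd₀ hμ4 hμ0 hβ hbox1 hbox2 hLip hu)

/-- **The shift lies in the box**: `|Re w| ≤ δ`, `|Im w| ≤ π/(4β)`, `|β Im w| ≤ π/4`. [cite: BenfattoGiulianiMastropietro2006, §2.3 (2.23)] -/
theorem hartreeShift_mem_box :
    |(hartreeShift L M β μ u).re| ≤ δ ∧ |(hartreeShift L M β μ u).im| ≤ Real.pi / (4 * β) ∧
      |β * (hartreeShift L M β μ u).im| ≤ Real.pi / 4 :=
  hartree_point_mem_box hd₀ hβ hbox1 hbox2 hu (norm_hartreeT1_le_one hd₀ hμ4 hμ0 hβ hbox1 hbox2 hLip hu)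

/-- **The Hartree residual after two Picard steps**: `‖-uT₁ + u T(w)‖ ≤ Lip² ‖u‖³ ≤ ‖u‖ π/β` when `κ_U² Lip² ≤ πβ`.
[cite: BenfattoGiulianiMastropietro2006, §2.3 (2.23)-(2.24)] -/
theorem norm_hartree_residual_le (hLip2 : κU ^ 2 * tadpoleLip L d₀ β ^ 2 ≤ Real.pi * β) :
    ‖-(u * hartreeT1 L M β μ u) + u * totalTadpole L M β μ (hartreeShift L M β μ u)‖ ≤ ‖u‖ * (Real.pi / β) := by
  have hβ0 : 0 < β := lt_of_lt_of_le (by positivity) hβ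
  have hL0 := tadpoleLip_nonneg (L := L) hd₀ hβ
  have hT0 := norm_hartreeT0_le_one (M := M) hd₀ hμ4 hμ0 hβ hbox1 hbox2 hLip hu
  have hT1 := norm_hartreeT1_le_one (M := M) hd₀ hμ4 hμ0 hβ hbox1 hbox2 hLip hu
  -- the three points
  obtain ⟨hre0, him0, -⟩ := hartree_point_mem_box hd₀ hβ hbox1 hbox2 hu (t := 0) (by simp)
  obtain ⟨hre1, him1, -⟩ := hartree_point_mem_box hd₀ hβ hbox1 hbox2 hu hT0
  obtain ⟨hre2, him2, -⟩ := hartree_point_mem_box hd₀ hβ hbox1 hbox2 hu hT1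
  simp only [mul_zero, sub_zero] at hre0 him0
  -- `T₁ - T₀`
  have hd10 : ‖hartreeT1 L M β μ u - hartreeT0 L M β μ u‖ ≤ tadpoleLip L d₀ β * ‖u‖ := by
    have h := norm_totalTadpole_sub_le (L := L) (M := M) hd₀ hμ4 hμ0 hβ hre1 him1 hre0 him0
    rw [hartreeT1, hartreeT0, ← tadpoleLip] at *
    refine h.trans ?_
    rw [show -(u / 2) - u * totalTadpole L M β μ (-(u / 2)) - -(u / 2) = -(u * totalTadpole L M β μ (-(u / 2))) by ring, norm_neg, norm_mul]
    calc tadpoleLip L d₀ β * (‖u‖ * ‖totalTadpole L M β μ (-(u / 2))‖) ≤ tadpoleLip L d₀ β * (‖u‖ * 1) := by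
          have : ‖totalTadpole L M β μ (-(u / 2))‖ ≤ 1 := by simpa [hartreeT0] using hT0
          gcongr
      _ = tadpoleLip L d₀ β * ‖u‖ := by ring
  -- `T(w) - T₁`
  have hd21 : ‖totalTadpole L M β μ (hartreeShift L M β μ u) - hartreeT1 L M β μ u‖ ≤ tadpoleLip L d₀ β ^ 2 * ‖u‖ ^ 2 := by
    have h := norm_totalTadpole_sub_le (L := L) (M := M) hd₀ hμ4 hμ0 hβ hre2 him2 hre1 him1
    rw [← tadpoleLip] at h
    rw [hartreeShift, hartreeT1]
    refine h.trans ?_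
    rw [show -(u / 2) - u * hartreeT1 L M β μ u - (-(u / 2) - u * hartreeT0 L M β μ u) =
      -(u * (hartreeT1 L M β μ u - hartreeT0 L M β μ u)) by ring, norm_neg, norm_mul]
    calc tadpoleLip L d₀ β * (‖u‖ * ‖hartreeT1 L M β μ u - hartreeT0 L M β μ u‖)
        ≤ tadpoleLip L d₀ β * (‖u‖ * (tadpoleLip L d₀ β * ‖u‖)) := by gcongr
      _ = tadpoleLip L d₀ β ^ 2 * ‖u‖ ^ 2 := by ring
  rw [show -(u * hartreeT1 L M β μ u) + u * totalTadpole L M β μ (hartreeShift L M β μ u) =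
    u * (totalTadpole L M β μ (hartreeShift L M β μ u) - hartreeT1 L M β μ u) by ring, norm_mul]
  refine mul_le_mul_of_nonneg_left (hd21.trans ?_) (norm_nonneg u)
  -- `Lip² ‖u‖² ≤ Lip² κU²/β² ≤ π/β`
  have hu2 : ‖u‖ ^ 2 ≤ (κU / β) ^ 2 := pow_le_pow_left₀ (norm_nonneg u) hu 2
  calc tadpoleLip L d₀ β ^ 2 * ‖u‖ ^ 2 ≤ tadpoleLip L d₀ β ^ 2 * (κU / β) ^ 2 := by gcongr
    _ = κU ^ 2 * tadpoleLip L d₀ β ^ 2 / β ^ 2 := by ring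
    _ ≤ Real.pi * β / β ^ 2 := by gcongr
    _ = Real.pi / β := by field_simp

end

end Literature.MathematicalPhysics.QuantumLattice

end
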